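import Summits.NavierStokesRegularity.NavierStokesRegularity.Theses.AxisymmetricExtremality
import Summits.NavierStokesRegularity.NavierStokesRegularity.Theorems.AxisymmetricExtremalityAxisymmetricKatoGlobalStubSereginLogSwirlOriginLerayLogHardy
import HarnessLib

/-!
# Seregin 2020, Lemma 2.2 (after Nazarov–Uraltseva 2012): the singular drift `2x'/|x'|²` has
# `|x'|^{-q} ∈ L¹(B(x₀, r))` with the scale-invariant bound `C_q r^{3-q}`, `q < 2`

Helper toward the stub `stub_seregin2020TypeII` of the crux `AxisymmetricKatoGlobal` (= the named
fact `Literature.Analysis.FluidPDE.Seregin2020_axisymmetricSingularPoint_typeII`, G. Seregin,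
Anal. Math. Phys. 10 (2020) Paper 46 = arXiv:2006.04140, Thm 2.1), now reduced to Lemma 2.2 of
the paper, whose printed proof is Nazarov–Uraltseva, St. Petersburg Math. J. 23 (2012) = arXiv:1011.1888,
§3 and Lemma 4.2. The drift of (2.12) is `b = u + b̂`, `b̂ = 2x'/|x'|²`, `|b̂| = 2/ϱ`; Nazarov–Uraltseva
use it through the scale-free quantity `R^{1-3/q}‖b̂‖_{q,B_R} = c_q`, `q < 2` (arXiv p. 14: "`b̂ ∈
L_{q,∞,loc}` for every `q < 2`"), i.e. through the bound `∫_{B(x₀,R)} ϱ^{-q} dx ≤ C_q R^{3-q}`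
uniformly in the centre. This file proves exactly that bound (piece P0′ of the session frontier):

* `lintegral_inv_cylRadius_rpow_axisCylinder_le` — on the cylinder `{ϱ < r, |x₃ - h| < r}` about
  the axis, `∫ ϱ^{-q} ≤ (4π/(2-q)) r^{3-q}` (cylindrical Tonelli `lintegral_eq_lintegral_cylindrical`
  and `∫₀^r ρ^{1-q} dρ = r^{2-q}/(2-q)`);
* `lintegral_inv_cylRadius_rpow_ball_le` — for `0 ≤ q < 2` there is `C` with
  `∫⁻_{B(x₀,r)} ϱ^{-q} ≤ C r^{3-q}` for every centre `x₀ ∈ ℝ³` and radius `r > 0` (split the ball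
  into its part in the cylinder `{ϱ < r, |x₃ - (x₀)₃| < r}` and the part where `ϱ ≥ r`, on which
  `ϱ^{-q} ≤ r^{-q}`).

## References

* G. Seregin, Anal. Math. Phys. 10 (2020), Paper 46 = arXiv:2006.04140, Lemma 2.2 (arXiv p. 8).
  [Seregin2020]
* A. I. Nazarov, N. N. Uraltseva, St. Petersburg Math. J. 23 (2012) 93–115 = arXiv:1011.1888,
  §4, the drift `b̂ = -(n-2)x'/|x'|²` and the constant `c_q = R^{1-n/q}‖b^{(2)}‖_{q,B_R}` (arXiv p. 14).
  [NazarovUraltseva2012]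
-/

-- the problem directory repeats the summit name (D-0017); core's `dupNamespace` linter fires
set_option linter.dupNamespace false

noncomputable section

open MeasureTheory Set Function Filter Topology Metric
open scoped NNReal ENNReal

namespace Summit.NavierStokesRegularity.NavierStokesRegularity.Theorems.AxisymmetricKatoGlobal.EulerScaling

open Literature.Analysis.FluidPDE

/-- `∫₀^r ρ^{1-q} dρ = r^{2-q}/(2-q)` for `q < 2`, as a lower Lebesgue integral. [folklore] -/
theorem lintegral_rpow_one_sub_Ioo {q : ℝ} (hq : q < 2) {r : ℝ} (hr : 0 < r) :
    ∫⁻ ρ in Ioo (0 : ℝ) r, ENNReal.ofReal (ρ ^ (1 - q)) = ENNReal.ofReal (r ^ (2 - q) / (2 - q)) := by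
  have h1 : -1 < 1 - q := by linarith
  have hint : IntegrableOn (fun ρ : ℝ => ρ ^ (1 - q)) (Ioo 0 r) := by
    have h := (intervalIntegral.intervalIntegrable_rpow' h1 (a := 0) (b := r))
    rw [intervalIntegrable_iff_integrableOn_Ioo_of_le hr.le] at h
    exact h
  have hnn : 0 ≤ᵐ[volume.restrict (Ioo (0 : ℝ) r)] fun ρ : ℝ => ρ ^ (1 - q) :=
    (ae_restrict_iff' measurableSet_Ioo).2 (Eventually.of_forall fun ρ hρ =>
      Real.rpow_nonneg hρ.1.le _)
  rw [← ofReal_integral_eq_lintegral_ofReal hint hnn]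
  congr 1
  rw [← integral_Ioc_eq_integral_Ioo, ← intervalIntegral.integral_of_le hr.le, integral_rpow (Or.inl h1),
    Real.zero_rpow (by linarith : 1 - q + 1 ≠ 0), sub_zero]
  congr 1 <;> ring_nf

/-- **`∫ ϱ^{-q}` over a cylinder about the axis.** For `q < 2`, `h ∈ ℝ` and `r > 0`,
`∫⁻_{ {ϱ < r, x₃ ∈ ]h-r, h+r[} } ϱ^{-q} dx ≤ (4π/(2-q)) r^{3-q}` (cylindrical coordinates:
`= 2r · 2π · ∫₀^r ρ^{1-q} dρ`). [cite: NazarovUraltseva2012, §4, the constant c_q of the drift 2x'/|x'|² (arXiv p. 14)] -/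
theorem lintegral_inv_cylRadius_rpow_axisCylinder_le {q : ℝ} (hq : q < 2) (h : ℝ) {r : ℝ} (hr : 0 < r) :
    ∫⁻ x in {x : EuclideanSpace ℝ (Fin 3) | cylRadius x < r ∧ x 2 ∈ Ioo (h - r) (h + r)},
        ENNReal.ofReal (cylRadius x ^ (-q)) ≤
      ENNReal.ofReal (4 * Real.pi / (2 - q) * r ^ (3 - q)) := by
  set S : Set (EuclideanSpace ℝ (Fin 3)) := {x | cylRadius x < r ∧ x 2 ∈ Ioo (h - r) (h + r)} with hS
  have h2c : Continuous fun x : EuclideanSpace ℝ (Fin 3) => x 2 := by fun_prop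
  have hSm : MeasurableSet S :=
    ((isOpen_lt continuous_cylRadius continuous_const).inter (isOpen_Ioo.preimage h2c)).measurableSet
  set f : EuclideanSpace ℝ (Fin 3) → ℝ≥0∞ := fun x => ENNReal.ofReal (cylRadius x ^ (-q)) with hf
  have hfm : Measurable f :=
    ENNReal.measurable_ofReal.comp (continuous_cylRadius.measurable.pow_const _)
  -- the one-dimensional factors
  set I₁ : ℝ → ℝ≥0∞ := (Ioo (h - r) (h + r)).indicator 1 with hI₁
  set I₂ : ℝ → ℝ≥0∞ := (Iio r).indicator fun ρ => ENNReal.ofReal (ρ ^ (1 - q)) with hI₂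
  have hI₂m : Measurable I₂ :=
    (ENNReal.measurable_ofReal.comp (measurable_id.pow_const _)).indicator measurableSet_Iio
  -- the integrand in cylindrical coordinates
  have hpt : ∀ (z θ : ℝ), ∀ ρ ∈ Ioi (0 : ℝ), ENNReal.ofReal ρ *
      S.indicator f (WithLp.toLp 2 ![ρ * Real.cos θ, ρ * Real.sin θ, z]) = I₁ z * I₂ ρ := by
    intro z θ ρ hρ
    have hρ0 : 0 < ρ := hρ
    have hrad : cylRadius (WithLp.toLp 2 ![ρ * Real.cos θ, ρ * Real.sin θ, z] : EuclideanSpace ℝ (Fin 3)) = ρ := by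
      rw [cylRadius_cylPt, abs_of_pos hρ0]
    have hmem : (WithLp.toLp 2 ![ρ * Real.cos θ, ρ * Real.sin θ, z] : EuclideanSpace ℝ (Fin 3)) ∈ S ↔
        ρ < r ∧ z ∈ Ioo (h - r) (h + r) := by
      simp only [hS, mem_setOf_eq, hrad]
      rfl
    by_cases hz : z ∈ Ioo (h - r) (h + r)
    · by_cases hρr : ρ < r
      · rw [indicator_of_mem (hmem.2 ⟨hρr, hz⟩), hI₁, hI₂, indicator_of_mem hz,
          indicator_of_mem (show ρ ∈ Iio r from hρr), Pi.one_apply, one_mul, hf]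
        beta_reduce
        rw [hrad, ← ENNReal.ofReal_mul hρ0.le]
        congr 1
        rw [show (1 : ℝ) - q = 1 + -q by ring, Real.rpow_add hρ0, Real.rpow_one]
      · rw [indicator_of_notMem (fun hm => hρr (hmem.1 hm).1), hI₂,
          indicator_of_notMem (show ρ ∉ Iio r from hρr), mul_zero, mul_zero]
    · rw [indicator_of_notMem (fun hm => hz (hmem.1 hm).2), hI₁, indicator_of_notMem hz,
        zero_mul, mul_zero]
  -- Tonelli in cylindrical coordinates
  rw [← lintegral_indicator hSm, lintegral_eq_lintegral_cylindrical (hfm.indicator hSm)]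
  have hinner : ∀ z θ : ℝ, ∫⁻ ρ in Ioi (0 : ℝ), ENNReal.ofReal ρ *
      S.indicator f (WithLp.toLp 2 ![ρ * Real.cos θ, ρ * Real.sin θ, z]) =
      I₁ z * ENNReal.ofReal (r ^ (2 - q) / (2 - q)) := by
    intro z θ
    rw [setLIntegral_congr_fun measurableSet_Ioi (hpt z θ), lintegral_const_mul _ hI₂m, hI₂,
      lintegral_indicator measurableSet_Iio, Measure.restrict_restrict measurableSet_Iio,
      Iio_inter_Ioi, lintegral_rpow_one_sub_Ioo hq hr]
  have hI₁m : Measurable I₁ := measurable_one.indicator measurableSet_Ioo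
  simp_rw [hinner, setLIntegral_const, mul_assoc]
  rw [lintegral_mul_const _ hI₁m, hI₁, lintegral_indicator_one measurableSet_Ioo, Real.volume_Ioo,
    Real.volume_Ioo]
  have h2q : 0 < 2 - q := by linarith
  have hb : 0 ≤ r ^ (2 - q) / (2 - q) := div_nonneg (Real.rpow_nonneg hr.le _) h2q.le
  have ha : 0 ≤ h + r - (h - r) := by linarith
  have e1 : r ^ (3 - q) = r * r ^ (2 - q) := by
    rw [show (3 : ℝ) - q = 1 + (2 - q) by ring, Real.rpow_add hr, Real.rpow_one]
  have e : ENNReal.ofReal (h + r - (h - r)) *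
      (ENNReal.ofReal (r ^ (2 - q) / (2 - q)) * ENNReal.ofReal (Real.pi - -Real.pi)) =
      ENNReal.ofReal (4 * Real.pi / (2 - q) * r ^ (3 - q)) := by
    rw [← ENNReal.ofReal_mul hb, ← ENNReal.ofReal_mul ha]
    congr 1
    rw [e1]
    field_simp
    ring
  rw [e]

/-- **P0′: `|x'|^{-q}` is integrable on balls with the scale-invariant bound, uniformly in the
centre.** For `0 ≤ q < 2` there is a constant `C` (depending on `q` only) such that for every
`x₀ ∈ ℝ³` and `r > 0`, `∫⁻_{B(x₀, r)} ϱ^{-q} dx ≤ C r^{3-q}` (`ϱ = cylRadius = |x'|`). This is the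
local `L_q`-integrability of the singular drift `b̂ = 2x'/|x'|²`, `|b̂| = 2/ϱ`, of (2.12) in the
scale-free form `R^{1-3/q}‖b̂‖_{q,B_R} ≤ c_q` used throughout Nazarov–Uraltseva's §3–§4 (the
worst centre is on the axis; a ball off the axis is split into its part inside the cylinder
`{ϱ < r, |x₃ - (x₀)₃| < r}` and the part where `ϱ ≥ r`, i.e. `ϱ^{-q} ≤ r^{-q}`).
[cite: NazarovUraltseva2012, §4, b̂ ∈ L_{q,∞,loc} for q < 2 and the constant c_q (arXiv p. 14)] -/
theorem lintegral_inv_cylRadius_rpow_ball_le : ∀ q : ℝ, 0 ≤ q → q < 2 → ∃ C : ℝ≥0,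
    ∀ (x₀ : EuclideanSpace ℝ (Fin 3)) (r : ℝ), 0 < r →
      ∫⁻ x in ball x₀ r, ENNReal.ofReal (cylRadius x ^ (-q)) ≤ (C : ℝ≥0∞) * ENNReal.ofReal (r ^ (3 - q)) := by
  intro q hq0 hq2
  -- the constant: `4π/(2-q)` for the cylinder part, `|B(0,1)|` for the far part
  set V : ℝ≥0∞ := volume (ball (0 : EuclideanSpace ℝ (Fin 3)) 1) with hV
  have hVlt : V < ∞ := measure_ball_lt_top
  set K : ℝ≥0∞ := ENNReal.ofReal (4 * Real.pi / (2 - q)) + V with hK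
  have hKlt : K < ∞ := ENNReal.add_lt_top.2 ⟨ENNReal.ofReal_lt_top, hVlt⟩
  refine ⟨K.toNNReal, fun x₀ r hr => ?_⟩
  rw [ENNReal.coe_toNNReal hKlt.ne]
  set f : EuclideanSpace ℝ (Fin 3) → ℝ≥0∞ := fun x => ENNReal.ofReal (cylRadius x ^ (-q)) with hf
  set A : Set (EuclideanSpace ℝ (Fin 3)) := {x | cylRadius x < r ∧ x 2 ∈ Ioo (x₀ 2 - r) (x₀ 2 + r)} with hA
  set B : Set (EuclideanSpace ℝ (Fin 3)) := ball x₀ r ∩ {x | r ≤ cylRadius x} with hB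
  -- the ball lies in `A ∪ B`
  have hsub : ball x₀ r ⊆ A ∪ B := by
    intro x hx
    by_cases hxr : cylRadius x < r
    · refine Or.inl ⟨hxr, ?_⟩
      have h2 : |x 2 - x₀ 2| < r := by
        have h := PiLp.norm_apply_le (x - x₀) 2
        rw [mem_ball, dist_eq_norm] at hx
        simp only [PiLp.sub_apply, Real.norm_eq_abs] at h
        exact lt_of_le_of_lt h hx
      rw [abs_lt] at h2
      exact ⟨by linarith [h2.1], by linarith [h2.2]⟩
    · exact Or.inr ⟨hx, not_lt.1 hxr⟩
  -- the far part
  have hBle : ∫⁻ x in B, f x ≤ V * ENNReal.ofReal (r ^ (3 - q)) := by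
    have hBm : MeasurableSet B := measurableSet_ball.inter (isClosed_le continuous_const continuous_cylRadius).measurableSet
    calc ∫⁻ x in B, f x ≤ ∫⁻ x in B, ENNReal.ofReal (r ^ (-q)) := by
          refine setLIntegral_mono' hBm fun x hx => ?_
          exact ENNReal.ofReal_le_ofReal (Real.rpow_le_rpow_of_nonpos hr hx.2 (by linarith))
      _ = ENNReal.ofReal (r ^ (-q)) * volume B := setLIntegral_const _ _
      _ ≤ ENNReal.ofReal (r ^ (-q)) * volume (ball x₀ r) := by gcongr; exact inter_subset_left
      _ = ENNReal.ofReal (r ^ (-q)) * (ENNReal.ofReal (r ^ 3) * V) := by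
          rw [Measure.addHaar_ball volume x₀ hr.le, finrank_euclideanSpace_fin]
      _ = V * ENNReal.ofReal (r ^ (3 - q)) := by
          rw [← mul_assoc, ← ENNReal.ofReal_mul (Real.rpow_nonneg hr.le _), mul_comm]
          congr 2
          rw [Real.rpow_sub hr, Real.rpow_neg hr.le, div_eq_mul_inv, mul_comm]
          norm_cast
  -- the cylinder part
  have h2q : 0 < 2 - q := by linarith
  have hAle : ∫⁻ x in A, f x ≤ ENNReal.ofReal (4 * Real.pi / (2 - q)) * ENNReal.ofReal (r ^ (3 - q)) := by
    rw [← ENNReal.ofReal_mul (by positivity)]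
    exact lintegral_inv_cylRadius_rpow_axisCylinder_le hq2 (x₀ 2) hr
  calc ∫⁻ x in ball x₀ r, f x ≤ ∫⁻ x in A ∪ B, f x := lintegral_mono_set hsub
    _ ≤ (∫⁻ x in A, f x) + ∫⁻ x in B, f x := lintegral_union_le _ _ _
    _ ≤ ENNReal.ofReal (4 * Real.pi / (2 - q)) * ENNReal.ofReal (r ^ (3 - q)) + V * ENNReal.ofReal (r ^ (3 - q)) :=
        add_le_add hAle hBle
    _ = K * ENNReal.ofReal (r ^ (3 - q)) := by rw [hK, add_mul]

end Summit.NavierStokesRegularity.NavierStokesRegularity.Theorems.AxisymmetricKatoGlobal.EulerScaling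

end
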